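import Mathlib
import Summits.CriticalPhenomena.CardyFormulaZ2.Theorems.CardySelfRefinementDefs
import Summits.CriticalPhenomena.CardyFormulaZ2.Theorems.CardySelfRefinementRussoDriftModel
import Summits.CriticalPhenomena.CardyFormulaZ2.Theorems.CardySelfRefinementTrivialSectorRateStubFourArmAboveOneExplorer
import Summits.CriticalPhenomena.CardyFormulaZ2.Theorems.CardySelfRefinementTrivialSectorRateStubFourArmAboveOneExplorerCentres
import Summits.CriticalPhenomena.CardyFormulaZ2.Theorems.CardySelfRefinementTrivialSectorRateStubFourArmAboveOneCircuitBits
import Literature.Probability.Percolation.RevealmentOrthogonality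
import Literature.Probability.Percolation.BoundaryExplorerRevealment
import Literature.Probability.Percolation.FourArmGarbanHolds
import Literature.Probability.Percolation.SelfRefinementMeasure
import HarnessLib

/-!
# Helper (M4b), part 3, of stub `stub_fourArmAboveOne`, line `far-field-is-a-quarter-turn`
(crux `TrivialSectorRate`, stmt-CriticalPhenomena-10266): the per-block inputs of Garban's scheme
for `M_k` — separation at an aligned block, revealment bound, the aligned grid, constants

The Garban scheme data `hS` of `fourArmAboveOneAlong_of_garbanScheme`
(file `…StubFourArmAboveOneReduction.lean`) for the self-refinement law `M_k(ρ,c₀)`, block by block: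

* `M_real_fourArmTwoClustersAt_le_setIntegral_mul_circuitWeight` — the chain
  `M_k(four arms at Q_j) ≤ E[Z w_j] = E[Z w_j ; Q_j pivotal] = E[Z w_j ; Q_j examined]` for one
  block `Q_j = j + B(b'+1)` ALIGNED with `kℤ²` (block estimate
  `M_real_fourArmTwoClustersAt_le_integral_mul_weight`, (B.5)
  `M_integral_mul_bit_eq_integral_indicator_pivotal`, "pivotal blocks are examined"
  `exists_mem_supp_of_pivotal` on lattice configurations, and
  `M_integral_indicator_pivotal_mul_bit_eq_setIntegral_revealed` of part 1);
* `M_real_revealed_le_real_openDualArmsAt` — the revealment event of a block has probability at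
  most a recentred two-arm probability (`hrev` with `K₃ = 1`, deterministic inclusion
  `setOf_exists_mem_supp_subset_openDualArmsAt`);
* `exists_eq_ctr_of_mem_gridCentres`, `ctr_aligned`, `disjoint_blockPairs_of_mem_gridCentres_of_le`
  — the grid of centres with spacing `k d'` consists of coarse vertices `k•u`, its blocks of radius
  `ρ ∈ kℕ` are aligned and, for spacing `≥ 2ρ + 1`, pairwise disjoint;
* `le_N_aux`, `card_bound_aux_aligned`, `ratio_bound_aux_aligned` — the arithmetic of the constants
  `K₁ = 1/(200(K₀+1))²`, `K₄ = 50(K₀+1)` for block radius `ρ ≤ 39 m` and spacing `d ≤ 81 m`;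
* `M_real_fourArmTwoClustersAt_le_mul_setIntegral` (registered helper) — **the separation input
  `hsep` for an ARBITRARY target centre `c`**: recentre at the block's coarse vertex
  (`M_real_fourArmTwoClustersAt_le_ctr`, part 2) and apply the chain, with `X = Z/2`,
  `C_j = ρs · w_j`, `K₂ = 2/ρs`.

Part 4 (file `…ExplorerAssembly.lean`) assembles `hS` along an RSW path and proves the stub.

References: O. Schramm, S. Smirnov (app. C. Garban), Ann. Probab. 39 (2011), App. B, proof of
Lemma B.1, (B.2)–(B.8); J. van den Berg, P. Nolin, Progr. Probab. 77 (2020), §5.2.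

Target file:
`Summits/CriticalPhenomena/CardyFormulaZ2/Theorems/CardySelfRefinementTrivialSectorRateStubFourArmAboveOneExplorerScheme.lean`.
-/

noncomputable section

namespace Summit.CriticalPhenomena.CardyFormulaZ2.Theorems.CardySelfRefinement.FarField

open scoped Classical
open Set MeasureTheory ProbabilityTheory
open Literature.Probability.LatticeModels Literature.Probability.Percolation
open Literature.Probability.Percolation.ProbeHistory
open Literature.Probability.Percolation.QuadCrossing
open Summit.CriticalPhenomena.CardyFormulaZ2.Theses.CardySelfRefinement

/-! ### The separation input at the centre of an aligned block, and the revealment bound -/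

/-- **`M_k(four arms at Q_j) ≤ E[Z w_j ; Y_j]` for one ALIGNED block** (registered helper of the
stub `stub_fourArmAboveOne`; the `M_k`-analogue of the tree's
`real_fourArm_le_setIntegral_mul_circuitWeight`, Garban's chain
`P⁴ ≲ P[Q_j pivotal] ≲ E[Z C_j] = E[Z C_j ; Q_j pivotal] = E[Z C_j ; Y_j]` with no arm
separation): for the cluster count `Z = numCrossingClusters · N R` (`N < R`), the re-weighted
circuit bit `w_j` read off `Q_j = j + B(b'+1)` ALIGNED with `kℤ²` (`k ∣ j i ± (b'+1)`), the hole
`j + B(h)` inside the circuit annulus `j + A_{a',b'}` (`1 ≤ h`, `h + 2 ≤ a' ≤ b'`, `Q_j ⊆ B(N)`,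
`b' + 2 + |j i| ≤ R`), the four-arm event `fourArmTwoClustersAt j h n` (`n ≥ R + |j i|`) and the
revealment event `Y_j` of `Q_j` by the boundary explorer of `B(R)`: the block estimate
`M_real_fourArmTwoClustersAt_le_integral_mul_weight`, (B.5)
`M_integral_mul_bit_eq_integral_indicator_pivotal`, "pivotal blocks are examined"
(`exists_mem_supp_of_pivotal`, on lattice configurations, which carry `M_k`) and
`M_integral_indicator_pivotal_mul_bit_eq_setIntegral_revealed`. -/
theorem M_real_fourArmTwoClustersAt_le_setIntegral_mul_circuitWeight {k : ℕ} (hk : 0 < k)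
    (ρ c₀ : ℝ) {N R : ℕ} (hNR : N < R) {j : Site 2} {h a' b' n : ℕ} (hh : 1 ≤ h)
    (hha : h + 2 ≤ a') (hab : a' ≤ b') (hV : ∀ x, x - j ∈ box 2 (b' + 1) → x ∈ box 2 N)
    (hb : ∀ i, (b' : ℤ) + 2 + |j i| ≤ R) (hn : ∀ i, (R : ℤ) + |j i| ≤ n)
    (hal : ∀ i, (k : ℤ) ∣ j i - ((b' + 1 : ℕ) : ℤ) ∧ (k : ℤ) ∣ j i + ((b' + 1 : ℕ) : ℤ))
    {pO pD : ℝ} (hpO : pO = (M k ρ c₀).real (openCircuitInAnnulusAt j a' b')) (hpO0 : 0 < pO)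
    (hpD : pD = (M k ρ c₀).real (dualCircuitInAnnulusAt j a' b')) (hpD0 : 0 < pD) :
    (M k ρ c₀).real (fourArmTwoClustersAt j h n) ≤
      ∫ ω in {ω | ∃ e ∈ blockPairs j (b' + 1), e ∈ supp ((boundaryExplorer R).hist (termTime R) ω)},
        (numCrossingClusters ω N R : ℝ) * circuitWeight j a' b' pO pD (obs ω (blockPairs j (b' + 1)))
        ∂(M k ρ c₀) := by
  have hZm := measurable_numCrossingClusters_real N R
  have hZb : ∀ ω : BondConfig (Site 2), |(numCrossingClusters ω N R : ℝ)| ≤ (box 2 N).card :=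
    fun ω => by rw [Nat.abs_cast]; exact_mod_cast numCrossingClusters_le_card ω N R
  have h0 := M_integral_circuitWeight_obs k ρ c₀ hpO hpO0 hpD hpD0
  -- (B.5): only pivotal configurations contribute
  have hB5 := M_integral_mul_bit_eq_integral_indicator_pivotal hk ρ c₀ hal
    (circuitWeight j a' b' pO pD) h0 hZm hZb
  -- pivotal blocks are examined (on lattice configurations, which carry `M_k`)
  have hpiv : ∀ᵐ ω ∂(M k ρ c₀), (∃ ξ ⊆ (↑(blockPairs j (b' + 1)) : Set (Sym2 (Site 2))),
      (numCrossingClusters (ω \ ↑(blockPairs j (b' + 1)) ∪ ξ) N R : ℝ) ≠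
        numCrossingClusters ω N R) →
      ∃ e ∈ blockPairs j (b' + 1), e ∈ supp ((boundaryExplorer R).hist (termTime R) ω) := by
    filter_upwards [selfRefinementMeasure_ae_subset_edgeSet k ρ c₀] with ω hω hξ
    exact exists_mem_supp_of_pivotal hω hNR (by omega) hV hξ
  have hB7 := M_integral_indicator_pivotal_mul_bit_eq_setIntegral_revealed hk ρ c₀ (boundaryExplorer R)
    (termTime R) hal (circuitWeight j a' b' pO pD) h0 hZm hZb hpiv
  -- (B.2)+(B.4): the block estimate
  have hB4 := M_real_fourArmTwoClustersAt_le_integral_mul_weight hk ρ c₀ hNR hh hha hab hV hb hn hal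
    hpO hpO0 hpD hpD0
  simp_rw [← circuitWeight_obs] at hB4
  rw [hB5, hB7] at hB4
  exact hB4

/-- **The revealment event of a block has `M_k`-probability at most a recentred two-arm
probability** (the input `hrev` of `hS`, with `K₃ = 1` and centre the block's own centre): the
deterministic inclusion `setOf_exists_mem_supp_subset_openDualArmsAt` (an examined block carries
an open arm and a dual arm from `j + B(r+2)` to distance `b`, `b + 1 + |j i| ≤ R`) holds for
every configuration, hence under every law. -/
theorem M_real_revealed_le_real_openDualArmsAt (k : ℕ) (ρ c₀ : ℝ) {R : ℕ} {j : Site 2} {r b : ℕ}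
    (n : ℕ) (hb : ∀ i, (b : ℤ) + 1 + |j i| ≤ R) :
    (M k ρ c₀).real {ω | ∃ e ∈ blockPairs j r, e ∈ supp ((boundaryExplorer R).hist n ω)} ≤
      (M k ρ c₀).real (openDualArmsAt j (r + 2) b) := by
  haveI := isProbabilityMeasure_M k ρ c₀
  exact measureReal_mono (setOf_exists_mem_supp_subset_openDualArmsAt n hb) (measure_ne_top _ _)

/-! ### The aligned grid of block centres -/

/-- **Grid centres with a spacing divisible by `k` are coarse vertices**: every centre of
`gridCentres (k d') L` is `k • u` for some `u ∈ ℤ²`. -/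
theorem exists_eq_ctr_of_mem_gridCentres {k d' L : ℕ} {j : Site 2}
    (hj : j ∈ gridCentres (k * d') L) : ∃ u : Site 2, j = ctr k u := by
  rw [gridCentres, Finset.mem_image] at hj
  obtain ⟨q, -, rfl⟩ := hj
  refine ⟨![(d' : ℤ) * ((q.1 : ℕ) - (L : ℤ)), (d' : ℤ) * ((q.2 : ℕ) - (L : ℤ))], funext fun i => ?_⟩
  fin_cases i
  · show gridCentre (k * d') L q 0 = _
    rw [gridCentre_apply_zero]
    simp only [ctr]
    push_cast
    ring
  · show gridCentre (k * d') L q 1 = _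
    rw [gridCentre_apply_one]
    simp only [ctr]
    push_cast
    ring

/-- **Blocks of the aligned grid are aligned**: for a centre `k • u` and a radius `R` divisible by
`k`, `k ∣ (k•u) i ± R`. -/
theorem ctr_aligned {k R : ℕ} (hR : k ∣ R) (u : Site 2) :
    ∀ i, (k : ℤ) ∣ ctr k u i - R ∧ (k : ℤ) ∣ ctr k u i + R := fun i =>
  ⟨Dvd.dvd.sub (Dvd.intro (u i) rfl) (Int.natCast_dvd_natCast.2 hR),
    Dvd.dvd.add (Dvd.intro (u i) rfl) (Int.natCast_dvd_natCast.2 hR)⟩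

-- adapted from Literature/Probability/Percolation/FourArmGarbanHolds.lean (`disjoint_blockPairs_of_mem_gridCentres`),
-- with the spacing relaxed from `2ρ + 1` to any `d ≥ 2ρ + 1`
/-- **The blocks of distinct centres are disjoint** when the spacing is at least `2ρ + 1`. -/
theorem disjoint_blockPairs_of_mem_gridCentres_of_le {ρ d L : ℕ} (hd : 2 * ρ + 1 ≤ d) {j j' : Site 2}
    (hj : j ∈ gridCentres d L) (hj' : j' ∈ gridCentres d L) (hne : j ≠ j') :
    Disjoint (blockPairs j ρ) (blockPairs j' ρ) := by
  rw [Finset.disjoint_left]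
  intro e he he'
  rw [mem_blockPairs_iff] at he he'
  obtain ⟨i, hi⟩ := exists_le_abs_sub_of_mem_gridCentres hj hj' hne
  induction e using Sym2.ind with
  | h x y =>
    have h1 := (mem_box.1 (he x (Sym2.mem_mk_left _ _))) i
    have h2 := (mem_box.1 (he' x (Sym2.mem_mk_left _ _))) i
    simp only [Pi.sub_apply] at h1 h2
    have hd' : (2 * ρ + 1 : ℤ) ≤ d := by exact_mod_cast hd
    cases abs_cases (j i - j' i) <;> omega

/-! ### Arithmetic of the constants of the aligned scheme -/

/-- `N ≥ 199 m` in the scheme regime `200 (K₀+1) N₀ m ≤ n < (K₀+1)(N+1)`. -/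
theorem le_N_aux {K₀ N₀ m n N : ℕ} (hN₀ : 1 ≤ N₀) (hmn : 200 * (K₀ + 1) * N₀ * m ≤ n)
    (hnN : n < (K₀ + 1) * (N + 1)) : 199 * m ≤ N := by
  have h1 : (K₀ + 1) * (200 * m) ≤ (K₀ + 1) * (200 * N₀ * m) := by
    refine Nat.mul_le_mul_left _ ?_
    calc 200 * m = 200 * 1 * m := by ring
      _ ≤ 200 * N₀ * m := Nat.mul_le_mul_right m (Nat.mul_le_mul_left 200 hN₀)
  have h2 : (K₀ + 1) * (200 * N₀ * m) ≤ n := by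
    calc (K₀ + 1) * (200 * N₀ * m) = 200 * (K₀ + 1) * N₀ * m := by ring
      _ ≤ n := hmn
  have h3 : (K₀ + 1) * (200 * m) < (K₀ + 1) * (N + 1) := lt_of_le_of_lt (h1.trans h2) hnN
  have h4 := Nat.lt_of_mul_lt_mul_left h3
  omega

-- adapted from Literature/Probability/Percolation/FourArmGarbanHolds.lean (`card_bound_aux`), constants for the aligned grid
/-- The count of aligned blocks: `(2L+1)² ≥ (n/m)² / (200 (K₀+1))²` when the block radius is
`ρ ≤ 39 m`, the spacing `d ≤ 81 m`, and `L = ⌊(N - ρ)/d⌋`. -/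
theorem card_bound_aux_aligned {K₀ N₀ m n N L ρ d : ℕ} (hN₀ : 1 ≤ N₀) (hm : 1 ≤ m)
    (hmn : 200 * (K₀ + 1) * N₀ * m ≤ n) (hnN : n < (K₀ + 1) * (N + 1)) (hρ : ρ ≤ 39 * m)
    (hd : d ≤ 81 * m) (hL : N - ρ < d * (L + 1)) (hρN : ρ ≤ N) :
    1 / (200 * ((K₀ : ℝ) + 1)) ^ 2 * ((n : ℝ) / m) ^ 2 ≤ (((2 * L + 1) ^ 2 : ℕ) : ℝ) := by
  have hm0 : (0 : ℝ) < m := by exact_mod_cast hm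
  have hK : (0 : ℝ) < (K₀ : ℝ) + 1 := by positivity
  have hNm : 199 * m ≤ N := le_N_aux hN₀ hmn hnN
  -- real forms of the hypotheses
  have hA : (N : ℝ) - ρ < d * ((L : ℝ) + 1) := by
    have h' : ((N - ρ : ℕ) : ℝ) = (N : ℝ) - ρ := by push_cast [Nat.cast_sub hρN]; ring
    rw [← h']; exact_mod_cast hL
  have hB : (n : ℝ) < ((K₀ : ℝ) + 1) * ((N : ℝ) + 1) := by exact_mod_cast hnN
  have hρ' : (ρ : ℝ) ≤ 39 * m := by exact_mod_cast hρ
  have hd' : (d : ℝ) ≤ 81 * m := by exact_mod_cast hd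
  have hm1 : (1 : ℝ) ≤ m := by exact_mod_cast hm
  have hL0 : (0 : ℝ) ≤ L := by positivity
  have hNm' : 199 * (m : ℝ) ≤ N := by exact_mod_cast hNm
  -- `N < 81 m L + 120 m`
  have hdL : (d : ℝ) * L ≤ 81 * m * L := mul_le_mul_of_nonneg_right hd' hL0
  have hNL : (N : ℝ) < 81 * (m * L) + 120 * m := by nlinarith
  -- multiply by `K₀ + 1`
  have h2 : ((K₀ : ℝ) + 1) * N < ((K₀ : ℝ) + 1) * (81 * (m * L) + 120 * m) :=
    mul_lt_mul_of_pos_left hNL hK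
  have h3 : ((K₀ : ℝ) + 1) ≤ ((K₀ : ℝ) + 1) * m := le_mul_of_one_le_right hK.le hm1
  have h4 : (0 : ℝ) ≤ ((K₀ : ℝ) + 1) * (m * L) := by positivity
  -- the main inequality `n ≤ (2L+1) (200 (K₀+1) m)`
  have hmain : (n : ℝ) ≤ (2 * (L : ℝ) + 1) * (200 * ((K₀ : ℝ) + 1) * m) := by nlinarith
  have hq : (0 : ℝ) ≤ (n : ℝ) / (200 * ((K₀ : ℝ) + 1) * m) := by positivity
  have hL1 : (n : ℝ) / (200 * ((K₀ : ℝ) + 1) * m) ≤ 2 * (L : ℝ) + 1 := by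
    rw [div_le_iff₀ (by positivity)]; exact hmain
  calc 1 / (200 * ((K₀ : ℝ) + 1)) ^ 2 * ((n : ℝ) / m) ^ 2
      = ((n : ℝ) / (200 * ((K₀ : ℝ) + 1) * m)) ^ 2 := by field_simp
    _ ≤ (2 * (L : ℝ) + 1) ^ 2 := pow_le_pow_left₀ hq hL1 2
    _ = (((2 * L + 1) ^ 2 : ℕ) : ℝ) := by push_cast; ring

-- adapted from Literature/Probability/Percolation/FourArmGarbanHolds.lean (`ratio_bound_aux`), constants for the aligned grid
/-- The ratio of the two-arm radii: `a₂/(R-N-1) ≤ 50 (K₀+1) m/n` for `a₂ ≤ 41 m`, `R = K₀ N`. -/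
theorem ratio_bound_aux_aligned {K₀ N₀ m n N R a₂ : ℕ} (hK₀ : 2 ≤ K₀) (hN₀ : 1 ≤ N₀) (hm : 1 ≤ m)
    (hmn : 200 * (K₀ + 1) * N₀ * m ≤ n) (hnN : n < (K₀ + 1) * (N + 1)) (hR : R = K₀ * N)
    (ha₂ : a₂ ≤ 41 * m) :
    ((a₂ : ℕ) : ℝ) / ((R - N - 1 : ℕ) : ℝ) ≤ 50 * ((K₀ : ℝ) + 1) * m / n := by
  have hN : 199 * m ≤ N := le_N_aux hN₀ hmn hnN
  have hMN : N ≤ R - N := by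
    obtain ⟨P, hP⟩ : ∃ P : ℕ, P = K₀ * N := ⟨_, rfl⟩
    have h2 : 2 * N ≤ P := by rw [hP]; exact Nat.mul_le_mul_right _ hK₀
    rw [← hP] at hR
    omega
  have hb1 : 1 ≤ R - N - 1 := by omega
  have hb0 : (0 : ℝ) < ((R - N - 1 : ℕ) : ℝ) := by exact_mod_cast hb1
  have hbN : (N : ℝ) - 1 ≤ ((R - N - 1 : ℕ) : ℝ) := by
    have : N - 1 ≤ R - N - 1 := by omega
    have h' : ((N - 1 : ℕ) : ℝ) = (N : ℝ) - 1 := by push_cast [Nat.cast_sub (show 1 ≤ N by omega)]; ring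
    rw [← h']; exact_mod_cast this
  have hB : (n : ℝ) < ((K₀ : ℝ) + 1) * ((N : ℝ) + 1) := by exact_mod_cast hnN
  have hm1 : (1 : ℝ) ≤ m := by exact_mod_cast hm
  have hK : (0 : ℝ) < (K₀ : ℝ) + 1 := by positivity
  have hmn' : 200 * ((K₀ : ℝ) + 1) * m ≤ n := by
    have h1 : 200 * (K₀ + 1) * m ≤ 200 * (K₀ + 1) * N₀ * m := by
      have := Nat.mul_le_mul_left (200 * (K₀ + 1) * m) hN₀
      nlinarith
    exact_mod_cast h1.trans hmn
  have hn0 : (0 : ℝ) < n := by nlinarith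
  have ha₂' : (a₂ : ℝ) ≤ 41 * m := by exact_mod_cast ha₂
  have hN' : (11 : ℝ) ≤ N := by
    have : 11 ≤ N := by omega
    exact_mod_cast this
  rw [div_le_div_iff₀ hb0 hn0]
  set B : ℝ := ((R - N - 1 : ℕ) : ℝ) with hBdef
  have h1 : ((K₀ : ℝ) + 1) * m * ((N : ℝ) - 1) ≤ ((K₀ : ℝ) + 1) * m * B :=
    mul_le_mul_of_nonneg_left hbN (by positivity)
  have h2 : (a₂ : ℝ) * n ≤ 41 * m * n := mul_le_mul_of_nonneg_right ha₂' hn0.le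
  have h3 : (m : ℝ) * n ≤ m * (((K₀ : ℝ) + 1) * ((N : ℝ) + 1)) :=
    mul_le_mul_of_nonneg_left hB.le (by positivity)
  have h4 : 91 * (((K₀ : ℝ) + 1) * m) ≤ 9 * (((K₀ : ℝ) + 1) * m) * N := by
    have h0 : (0 : ℝ) ≤ ((K₀ : ℝ) + 1) * m := by positivity
    nlinarith
  nlinarith

/-! ### The separation input of `hS` at an arbitrary centre -/

/-- **The separation input `hsep` of `hS` for `M_k`, one aligned block, arbitrary target centre**
(registered helper of the stub `stub_fourArmAboveOne`): for the block of the coarse vertex `u`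
(`Q = k•u + B(b'+1)`, `k ∣ b' + 1`, hole `k•u + B(h)`, circuit annulus `k•u + A_{a',b'}` with
`h + 2 ≤ a' ≤ b'`, `Q ⊆ B(N)`, `b' + 2 + k|u i| ≤ R`, `R + k|u i| ≤ n₄`), circuit probabilities
`pO, pΔ ≥ ρs > 0`, the field `X = Z/2` and the bit `C = ρs · w`, and ANY centre `c` with radii
`1 ≤ m`, `m + k < h < n₄`, `n₄ + k ≤ n`:
`M_k(fourArmTwoClustersAt c m n) ≤ (2/ρs) ∫_{Q examined} X C dM_k` — recentre at `k•u`
(`M_real_fourArmTwoClustersAt_le_ctr`), then the chain at the block centre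
(`M_real_fourArmTwoClustersAt_le_setIntegral_mul_circuitWeight`). -/
theorem M_real_fourArmTwoClustersAt_le_mul_setIntegral {k : ℕ} (hk : 0 < k) (ρ c₀ : ℝ)
    {N R : ℕ} (hNR : N < R) (c u : Site 2) {m n h a' b' n₄ : ℕ} (hm : 1 ≤ m) (hmh : m + k < h)
    (hhn : h < n₄) (hn₄ : n₄ + k ≤ n) (hha : h + 2 ≤ a') (hab : a' ≤ b')
    (hV : ∀ x, x - ctr k u ∈ box 2 (b' + 1) → x ∈ box 2 N)
    (hb : ∀ i, (b' : ℤ) + 2 + |ctr k u i| ≤ R) (hn : ∀ i, (R : ℤ) + |ctr k u i| ≤ n₄)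
    (hkb : k ∣ b' + 1) {ρs pO pD : ℝ} (hρs : 0 < ρs)
    (hpO : pO = (M k ρ c₀).real (openCircuitInAnnulusAt (ctr k u) a' b')) (hρO : ρs ≤ pO)
    (hpD : pD = (M k ρ c₀).real (dualCircuitInAnnulusAt (ctr k u) a' b')) (hρD : ρs ≤ pD) :
    (M k ρ c₀).real (fourArmTwoClustersAt c m n) ≤
      2 / ρs * ∫ ω in {ω | ∃ e ∈ blockPairs (ctr k u) (b' + 1),
          e ∈ supp ((boundaryExplorer R).hist (termTime R) ω)},
        (numCrossingClusters ω N R : ℝ) / 2 *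
          (ρs * circuitWeight (ctr k u) a' b' pO pD (obs ω (blockPairs (ctr k u) (b' + 1))))
        ∂(M k ρ c₀) := by
  have h1 := M_real_fourArmTwoClustersAt_le_ctr hk ρ c₀ c u hm hmh hhn hn₄
  have h2 := M_real_fourArmTwoClustersAt_le_setIntegral_mul_circuitWeight hk ρ c₀ hNR (by omega) hha hab
    hV hb hn (ctr_aligned hkb u) hpO (hρs.trans_le hρO) hpD (hρs.trans_le hρD)
  have hXC : ∀ ω : BondConfig (Site 2), (numCrossingClusters ω N R : ℝ) / 2 *
      (ρs * circuitWeight (ctr k u) a' b' pO pD (obs ω (blockPairs (ctr k u) (b' + 1)))) =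
      (ρs / 2) * ((numCrossingClusters ω N R : ℝ) *
        circuitWeight (ctr k u) a' b' pO pD (obs ω (blockPairs (ctr k u) (b' + 1)))) := fun ω => by
    ring
  simp_rw [hXC]
  rw [integral_const_mul, ← mul_assoc, show (2 : ℝ) / ρs * (ρs / 2) = 1 from by field_simp, one_mul]
  exact h1.trans h2

end Summit.CriticalPhenomena.CardyFormulaZ2.Theorems.CardySelfRefinement.FarField

end
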